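import Summits.QuantumFields.QCD.Theorems.PauliWegnerSeaChiralGluonicCompletionGoldstoneOfHereditaryPin

/-!
# Crux `ChiralGluonicCompletion` (stmt-QuantumFields-17498), line `Sketch` — calibration of the chirality stub E*
# (`stub_hereditaryPin`): the hereditary pin IS the eventual pin along a subsequence, IS scale-coherence of the typed pin

The registered stub E* of skeleton rev 5 asks, from the crux's package `Hyp N_f reg`, for SOME subsequence
`reg.restrict φ` that is chiral at zero along EVERY further subsequence.  The typed pin `reg.IsChiralAtZero` negates an
`∀ᶠ k` clause, so it only says: for every rate `ε > 0`, at an `ε`-dependent positive tuple and channel, the `ε`-gap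
bound is violated at every level FREQUENTLY in `k`.  This file proves the exact order-theoretic calibration of E*
(pure bookkeeping, no physics):

* `exists_extraction_eventually_violated` — **single-scale selection from the typed pin**: a violated gap clause at ONE
  rate gives a subsequence along which the violations (same tuple, same channel) hold at every level EVENTUALLY
  (`Filter.extraction_forall_of_frequently` at the levels `C = 0, 1, 2, …`).  So `Hyp` delivers, for each single rate,
  a hereditarily-violating subsequence — but an `ε`-dependent one.
* `hereditaryPin_of_eventualPin` — an eventual pin along `Φ` (every rate, eventually in `j`, read on the cutoffs
  `Φ j`) makes `reg.restrict Φ` hereditarily chiral (the landed `hereditaryPin_of_eventual` at `reg.restrict Φ`).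
* `exists_eventualPin_of_hereditaryPin` — **conversely**, if `reg.restrict φ` is hereditarily chiral, some further
  subsequence `φ ∘ θ` carries the EVENTUAL pin at every rate: nested single-scale selections at the rates `1/(i+1)`
  (available because every subsequence is still pinned), then the landed diagonal `exists_diagonal`.
* `hereditaryPin_iff_exists_eventualPin` — hence **E* for `reg` ⟺ the eventual (`∀ᶠ`) pin along some subsequence**,
  i.e. exactly the hypothesis of `hereditaryPin_of_eventual` for some `reg.restrict φ`.
* `hereditaryPin_iff_eventualPin_along_subsequences` — the same, read through the data of `reg.restrict θ` (the
  registered sub-goal of the line; definitional rephrasing).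
* `hereditaryPin_iff_scaleCoherent` — equivalently **E* ⟺ scale-coherence of the typed pin**: there are a null
  sequence of rates `u i` and witnesses `(m_i, A_i, B_i)` such that for every `i` and every level `C` the violations
  at the first `i + 1` scales happen SIMULTANEOUSLY frequently in `k`.  The typed pin is the case of one scale at a
  time; the residual content of the stub over `Hyp` is precisely this finite-intersection property of the per-scale
  violation sets.  No clause of `Hyp` is known to supply it ((i)–(iv) and PQFD carry `m`-dependent constants and say
  nothing as `m → 0⁺`); abstractly (violation sets prescribed freely) it fails for "fragmented" families — violations
  at rate `1/i` only on a block `P_i` of cutoffs, the blocks pairwise disjoint — so the stub is not closed by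
  bookkeeping.  What closes it: the eventual pin for the given `reg` (`hereditaryPin_of_eventual`, `φ = id`), e.g.
  from `reg.HasGoldstoneBound`.
-/

noncomputable section

namespace Summit.QuantumFields.QCD.Theorems.StronglyChiralSubsequence

open MeasureTheory Filter Topology
open Literature.MathematicalPhysics.QuantumFieldTheory Literature.MathematicalPhysics.QuantumLattice
  Literature.Probability.LatticeModels

variable {Nf : ℕ}

/-- Level monotonicity of a violation: a violation at level `C' ≥ C` is one at level `C`. -/
private theorem viol_of_level_le {C C' e r : ℝ} (he : 0 ≤ e) (hCC' : C ≤ C') (h : C' * e < r) : C * e < r :=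
  (mul_le_mul_of_nonneg_right hCC' he).trans_lt h

/-- Rate monotonicity of a violation: a violation at rate `ε` and level `max C 0` is one at every rate `ε' ≥ ε` and
level `C` (`x ≥ 0`). -/
private theorem viol_of_rate_le {ε ε' x C r : ℝ} (hx : 0 ≤ x) (hεε' : ε ≤ ε')
    (h : max C 0 * Real.exp (-(ε * x)) < r) : C * Real.exp (-(ε' * x)) < r :=
  calc C * Real.exp (-(ε' * x)) ≤ max C 0 * Real.exp (-(ε' * x)) :=
        mul_le_mul_of_nonneg_right (le_max_left _ _) (Real.exp_pos _).le
    _ ≤ max C 0 * Real.exp (-(ε * x)) :=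
        mul_le_mul_of_nonneg_left (Real.exp_le_exp.2 (by nlinarith [mul_le_mul_of_nonneg_right hεε' hx]))
          (le_max_right _ _)
    _ < r := h

/-- Eventual statements along `Θ₁` pass to every `Θ₂` that is eventually a reindexing `Θ₁ ∘ θ` with `θ → ∞`. -/
private theorem eventually_of_eventuallyEq_comp {V : ℕ → Prop} {Θ₁ Θ₂ θ : ℕ → ℕ}
    (hθ : Tendsto θ atTop atTop) (heq : ∀ᶠ j in atTop, Θ₂ j = Θ₁ (θ j)) (h : ∀ᶠ j in atTop, V (Θ₁ j)) :
    ∀ᶠ j in atTop, V (Θ₂ j) := by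
  filter_upwards [hθ.eventually h, heq] with j hj hje
  rw [hje]
  exact hj

/-! ## §1 Single-scale selection from the typed pin -/

/-- **Single-scale selection.**  If the lattice theory of `reg` at the tuple `m` does NOT have the uniform gap `ε`
(the typed clause: one channel violating every level frequently in `k`), then along some subsequence `φ` the
violations in that channel hold at every level EVENTUALLY: extract `φ` with a violation at level `t` at the cutoff
`φ t` (`Filter.extraction_forall_of_frequently`); at level `C` every `t ≥ C` serves. -/
theorem exists_extraction_eventually_violated (reg : QCDRegularisation Nf) {m : Fin Nf → ℝ} {ε : ℝ}
    (h : ¬ (reg.scheme m 0 0).HasLatticeMassGap ε) :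
    ∃ φ : ℕ → ℕ, StrictMono φ ∧
      ∃ (R R' : ℕ) (A : QCDLatticeObservable Nf R) (B : QCDLatticeObservable Nf R'), ∀ C : ℝ,
        ∀ᶠ j in atTop, ∃ S : ℕ, reg.L (φ j) ≤ S ∧ ∃ n : ℕ, n ≤ S ∧
          C * Real.exp (-(ε * (reg.a (φ j) * n))) <
            ‖qcdLatticeConnectedCorr (reg.β (φ j)) (2 * S + 1) (fun fl => (reg.scheme m 0 0).mq fl (φ j)) A B n‖ := by
  simp only [QCDScheme.HasLatticeMassGap, not_forall, not_exists, Filter.not_eventually, not_le] at h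
  obtain ⟨R, R', A, B, hviol⟩ := h
  -- a violation at level `t` at the cutoff `φ t`, `φ` strictly increasing
  obtain ⟨φ, hφ, hφviol⟩ := extraction_forall_of_frequently fun t : ℕ => hviol (t : ℝ)
  refine ⟨φ, hφ, R, R', A, B, fun C => ?_⟩
  filter_upwards [tendsto_natCast_atTop_atTop.eventually_ge_atTop C] with t ht
  obtain ⟨S, hS, n, hn, hlt⟩ := hφviol t
  exact ⟨S, hS, n, hn, viol_of_level_le (Real.exp_pos _).le ht hlt⟩

/-- **What the typed pin gives, scale by scale.**  From `reg.IsChiralAtZero`, for each SINGLE rate `ε > 0` there is a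
subsequence `reg.restrict φ` along which the pin at rate `ε` holds with eventual violations, hence hereditarily — but
the subsequence depends on `ε`, and the stub needs one subsequence for all rates. -/
theorem exists_extraction_eventually_violated_of_isChiralAtZero (reg : QCDRegularisation Nf)
    (hpin : reg.IsChiralAtZero) {ε : ℝ} (hε : 0 < ε) :
    ∃ φ : ℕ → ℕ, StrictMono φ ∧ ∃ m : Fin Nf → ℝ, (∀ f, 0 < m f) ∧
      ∃ (R R' : ℕ) (A : QCDLatticeObservable Nf R) (B : QCDLatticeObservable Nf R'), ∀ C : ℝ,
        ∀ᶠ j in atTop, ∃ S : ℕ, reg.L (φ j) ≤ S ∧ ∃ n : ℕ, n ≤ S ∧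
          C * Real.exp (-(ε * (reg.a (φ j) * n))) <
            ‖qcdLatticeConnectedCorr (reg.β (φ j)) (2 * S + 1) (fun fl => (reg.scheme m 0 0).mq fl (φ j)) A B n‖ := by
  obtain ⟨m, hm, hng⟩ := hpin ε hε
  obtain ⟨φ, hφ, R, R', A, B, hev⟩ := exists_extraction_eventually_violated reg hng
  exact ⟨φ, hφ, m, hm, R, R', A, B, hev⟩

/-! ## §2 The eventual pin along a subsequence is hereditary -/

/-- **An eventual pin along `Φ` is hereditary along `Φ`**: if for every rate some positive tuple and one channel
violate the gap bound at every level for all large `j` at the cutoffs `Φ j`, then every subsequence of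
`reg.restrict Φ` is chiral at zero (`hereditaryPin_of_eventual` at `reg.restrict Φ`, whose data are `reg`'s along `Φ`). -/
theorem hereditaryPin_of_eventualPin (reg : QCDRegularisation Nf) (Φ : ℕ → ℕ) (hΦ : StrictMono Φ)
    (h : ∀ ε > (0 : ℝ), ∃ m : Fin Nf → ℝ, (∀ f, 0 < m f) ∧
      ∃ (R R' : ℕ) (A : QCDLatticeObservable Nf R) (B : QCDLatticeObservable Nf R'), ∀ C : ℝ,
        ∀ᶠ j in atTop, ∃ S : ℕ, reg.L (Φ j) ≤ S ∧ ∃ n : ℕ, n ≤ S ∧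
          C * Real.exp (-(ε * (reg.a (Φ j) * n))) <
            ‖qcdLatticeConnectedCorr (reg.β (Φ j)) (2 * S + 1) (fun fl => (reg.scheme m 0 0).mq fl (Φ j)) A B n‖)
    (ψ : ℕ → ℕ) (hψ : StrictMono ψ) :
    ((reg.restrict Φ hΦ.tendsto_atTop).restrict ψ hψ.tendsto_atTop).IsChiralAtZero :=
  hereditaryPin_of_eventual (reg.restrict Φ hΦ.tendsto_atTop) h ψ hψ

/-! ## §3 Conversely: a hereditary pin yields the eventual pin along a further subsequence -/

/-- **E* ⟹ the eventual pin along a subsequence.**  If `reg.restrict φ` is chiral at zero along every further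
subsequence, then some `Φ = φ ∘ θ` carries the eventual pin at every rate: by `exists_diagonal` over the properties
`P i Θ` = "eventual violations at rate `1/(i+1)` along `φ ∘ Θ` in some channel at some positive tuple" — reachable from
every `ψ` (the subsequence `φ ∘ ψ` is pinned by heredity; select at the single scale `1/(i+1)`,
`exists_extraction_eventually_violated`) and stable under eventual reindexing — and a violation at rate
`1/(i+1) < ε` is one at rate `ε`. -/
theorem exists_eventualPin_of_hereditaryPin (reg : QCDRegularisation Nf) (φ : ℕ → ℕ) (hφ : StrictMono φ)
    (hher : ∀ (ψ : ℕ → ℕ) (hψ : StrictMono ψ),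
      ((reg.restrict φ hφ.tendsto_atTop).restrict ψ hψ.tendsto_atTop).IsChiralAtZero) :
    ∃ Φ : ℕ → ℕ, StrictMono Φ ∧ (∃ θ : ℕ → ℕ, StrictMono θ ∧ Φ = φ ∘ θ) ∧
      ∀ ε > (0 : ℝ), ∃ m : Fin Nf → ℝ, (∀ f, 0 < m f) ∧
        ∃ (R R' : ℕ) (A : QCDLatticeObservable Nf R) (B : QCDLatticeObservable Nf R'), ∀ C : ℝ,
          ∀ᶠ j in atTop, ∃ S : ℕ, reg.L (Φ j) ≤ S ∧ ∃ n : ℕ, n ≤ S ∧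
            C * Real.exp (-(ε * (reg.a (Φ j) * n))) <
              ‖qcdLatticeConnectedCorr (reg.β (Φ j)) (2 * S + 1) (fun fl => (reg.scheme m 0 0).mq fl (Φ j)) A B n‖ := by
  obtain ⟨Θ, hΘ, hP⟩ := exists_diagonal
    (P := fun i Θ => ∃ m : Fin Nf → ℝ, (∀ f, 0 < m f) ∧
      ∃ (R R' : ℕ) (A : QCDLatticeObservable Nf R) (B : QCDLatticeObservable Nf R'), ∀ C : ℝ,
        ∀ᶠ j in atTop, ∃ S : ℕ, reg.L (φ (Θ j)) ≤ S ∧ ∃ n : ℕ, n ≤ S ∧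
          C * Real.exp (-(1 / ((i : ℝ) + 1) * (reg.a (φ (Θ j)) * n))) <
            ‖qcdLatticeConnectedCorr (reg.β (φ (Θ j))) (2 * S + 1)
              (fun fl => (reg.scheme m 0 0).mq fl (φ (Θ j))) A B n‖)
    (fun i ψ hψ => by
      -- `φ ∘ ψ` is still pinned: select at the single scale `1/(i+1)`
      obtain ⟨m, hm, hng⟩ := hher ψ hψ (1 / ((i : ℝ) + 1)) Nat.one_div_pos_of_nat
      obtain ⟨σ, hσ, R, R', A, B, hev⟩ :=
        exists_extraction_eventually_violated ((reg.restrict φ hφ.tendsto_atTop).restrict ψ hψ.tendsto_atTop) hng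
      exact ⟨σ, hσ, m, hm, R, R', A, B, hev⟩)
    (fun i Θ₁ Θ₂ θ _ _ hθ heq h => by
      obtain ⟨m, hm, R, R', A, B, hev⟩ := h
      exact ⟨m, hm, R, R', A, B, fun C =>
        eventually_of_eventuallyEq_comp (V := fun k => ∃ S : ℕ, reg.L (φ k) ≤ S ∧ ∃ n : ℕ, n ≤ S ∧
          C * Real.exp (-(1 / ((i : ℝ) + 1) * (reg.a (φ k) * n))) <
            ‖qcdLatticeConnectedCorr (reg.β (φ k)) (2 * S + 1) (fun fl => (reg.scheme m 0 0).mq fl (φ k)) A B n‖)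
          hθ heq (hev C)⟩)
  refine ⟨φ ∘ Θ, hφ.comp hΘ, ⟨Θ, hΘ, rfl⟩, fun ε hε => ?_⟩
  -- a rate `1/(i+1) < ε`; violations at rate `1/(i+1)` and level `max C 0` are violations at rate `ε` and level `C`
  obtain ⟨i, hi⟩ := exists_nat_one_div_lt hε
  obtain ⟨m, hm, R, R', A, B, hev⟩ := hP i
  refine ⟨m, hm, R, R', A, B, fun C => ?_⟩
  filter_upwards [hev (max C 0)] with j hj
  obtain ⟨S, hS, n, hn, hlt⟩ := hj
  exact ⟨S, hS, n, hn,
    viol_of_rate_le (mul_nonneg (reg.a_pos _).le (Nat.cast_nonneg n)) hi.le hlt⟩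

/-! ## §4 The calibration of E* -/

/-- **E* ⟺ the eventual pin along a subsequence.**  The conclusion of `stub_hereditaryPin` for `reg` — some
subsequence chiral at zero along all its subsequences — holds iff along some subsequence `φ` the pin holds in the
EVENTUAL form: for every rate a positive tuple and one channel violating every level of the gap bound for all large
`j` at the cutoffs `φ j` (the hypothesis of `hereditaryPin_of_eventual` for `reg.restrict φ`).  The crux's typed pin is
the `∃ᶠ` form of this along `id`. -/
theorem hereditaryPin_iff_exists_eventualPin (reg : QCDRegularisation Nf) :
    (∃ φ : ℕ → ℕ, ∃ hφ : StrictMono φ, ∀ (ψ : ℕ → ℕ) (hψ : StrictMono ψ),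
        ((reg.restrict φ hφ.tendsto_atTop).restrict ψ hψ.tendsto_atTop).IsChiralAtZero) ↔
      ∃ φ : ℕ → ℕ, StrictMono φ ∧ ∀ ε > (0 : ℝ), ∃ m : Fin Nf → ℝ, (∀ f, 0 < m f) ∧
        ∃ (R R' : ℕ) (A : QCDLatticeObservable Nf R) (B : QCDLatticeObservable Nf R'), ∀ C : ℝ,
          ∀ᶠ j in atTop, ∃ S : ℕ, reg.L (φ j) ≤ S ∧ ∃ n : ℕ, n ≤ S ∧
            C * Real.exp (-(ε * (reg.a (φ j) * n))) <
              ‖qcdLatticeConnectedCorr (reg.β (φ j)) (2 * S + 1) (fun fl => (reg.scheme m 0 0).mq fl (φ j)) A B n‖ := by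
  constructor
  · rintro ⟨φ, hφ, hher⟩
    obtain ⟨Φ, hΦ, -, hev⟩ := exists_eventualPin_of_hereditaryPin reg φ hφ hher
    exact ⟨Φ, hΦ, hev⟩
  · rintro ⟨φ, hφ, hev⟩
    exact ⟨φ, hφ, hereditaryPin_of_eventualPin reg φ hφ hev⟩

/-- **E* ⟺ the eventual pin along a subsequence** — the registered sub-goal of the line, in the form read through
the data of the subsequence `reg.restrict θ` (verbatim the hypothesis of `hereditaryPin_of_eventual` for
`reg.restrict θ`; definitionally the previous theorem, `(reg.restrict θ _).L l = reg.L (θ l)` etc. by `rfl`). -/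
theorem hereditaryPin_iff_eventualPin_along_subsequences : ∀ {Nf : ℕ} (reg : QCDRegularisation Nf), (∃ φ : ℕ → ℕ, ∃ hφ : StrictMono φ, ∀ (ψ : ℕ → ℕ) (hψ : StrictMono ψ), ((reg.restrict φ hφ.tendsto_atTop).restrict ψ hψ.tendsto_atTop).IsChiralAtZero) ↔ ∃ θ : ℕ → ℕ, ∃ hθ : StrictMono θ, ∀ ε > (0 : ℝ), ∃ m : Fin Nf → ℝ, (∀ f, 0 < m f) ∧ ∃ (R R' : ℕ) (A : QCDLatticeObservable Nf R) (B : QCDLatticeObservable Nf R'), ∀ C : ℝ, ∀ᶠ l in atTop, ∃ S : ℕ, (reg.restrict θ hθ.tendsto_atTop).L l ≤ S ∧ ∃ n : ℕ, n ≤ S ∧ C * Real.exp (-(ε * ((reg.restrict θ hθ.tendsto_atTop).a l * n))) < ‖qcdLatticeConnectedCorr ((reg.restrict θ hθ.tendsto_atTop).β l) (2 * S + 1) (fun fl => ((reg.restrict θ hθ.tendsto_atTop).scheme m 0 0).mq fl l) A B n‖ := by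
  intro Nf reg
  rw [hereditaryPin_iff_exists_eventualPin]
  constructor
  · rintro ⟨θ, hθ, hev⟩
    exact ⟨θ, hθ, hev⟩
  · rintro ⟨θ, hθ, hev⟩
    exact ⟨θ, hθ, hev⟩

/-! ## §5 E* as scale-coherence of the typed pin -/

/-- **Scale-coherence ⟹ E*.**  If there are rates `u i → 0` and witnesses `(m_i > 0, A_i, B_i)` such that for every
`i` and every level `C` the cutoffs `k` at which the gap bounds at ALL the scales `u 0, …, u i` are violated at level
`C` (each in its own channel at its own tuple) are infinite in number, then some subsequence of `reg` is hereditarily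
chiral: extract `φ t` among the simultaneous violations of the first `t + 1` scales at level `t`; along `φ` every scale
is violated at every level eventually, and `hereditaryPin_of_eventualPin` applies. -/
theorem hereditaryPin_of_scaleCoherent (reg : QCDRegularisation Nf) (u : ℕ → ℝ) (hu : Tendsto u atTop (𝓝 0))
    (m : ℕ → Fin Nf → ℝ) (hm : ∀ i f, 0 < m i f) (R R' : ℕ → ℕ)
    (A : ∀ i, QCDLatticeObservable Nf (R i)) (B : ∀ i, QCDLatticeObservable Nf (R' i))
    (h : ∀ (i : ℕ) (C : ℝ), ∃ᶠ k in atTop, ∀ i' ≤ i, ∃ S : ℕ, reg.L k ≤ S ∧ ∃ n : ℕ, n ≤ S ∧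
      C * Real.exp (-(u i' * (reg.a k * n))) <
        ‖qcdLatticeConnectedCorr (reg.β k) (2 * S + 1) (fun fl => (reg.scheme (m i') 0 0).mq fl k) (A i') (B i') n‖) :
    ∃ φ : ℕ → ℕ, ∃ hφ : StrictMono φ, ∀ (ψ : ℕ → ℕ) (hψ : StrictMono ψ),
      ((reg.restrict φ hφ.tendsto_atTop).restrict ψ hψ.tendsto_atTop).IsChiralAtZero := by
  -- `φ t`: a cutoff with simultaneous violations of the scales `u 0, …, u t` at level `t`
  obtain ⟨φ, hφ, hφviol⟩ := extraction_forall_of_frequently fun t : ℕ => h t (t : ℝ)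
  refine ⟨φ, hφ, hereditaryPin_of_eventualPin reg φ hφ fun ε hε => ?_⟩
  -- a scale `u i < ε`
  obtain ⟨i, hi⟩ := (hu.eventually (eventually_lt_nhds hε)).exists
  refine ⟨m i, hm i, R i, R' i, A i, B i, fun C => ?_⟩
  filter_upwards [eventually_ge_atTop i, tendsto_natCast_atTop_atTop.eventually_ge_atTop (max C 0)] with t hti htC
  obtain ⟨S, hS, n, hn, hlt⟩ := hφviol t i hti
  exact ⟨S, hS, n, hn, viol_of_rate_le (mul_nonneg (reg.a_pos _).le (Nat.cast_nonneg n)) hi.le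
    (viol_of_level_le (Real.exp_pos _).le htC hlt)⟩

/-- **E* ⟹ scale-coherence.**  Conversely, if some subsequence of `reg` is hereditarily chiral, the typed pin of
`reg` is scale-coherent: along the eventual-pin subsequence `Φ` of `exists_eventualPin_of_hereditaryPin` the
violations at the rates `1/(i+1)` (witnesses `m_i, A_i, B_i`) are eventual, so finitely many of them hold
simultaneously eventually along `Φ`, in particular frequently in `k`. -/
theorem scaleCoherent_of_hereditaryPin (reg : QCDRegularisation Nf)
    (hE : ∃ φ : ℕ → ℕ, ∃ hφ : StrictMono φ, ∀ (ψ : ℕ → ℕ) (hψ : StrictMono ψ),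
      ((reg.restrict φ hφ.tendsto_atTop).restrict ψ hψ.tendsto_atTop).IsChiralAtZero) :
    ∃ (u : ℕ → ℝ), Tendsto u atTop (𝓝 0) ∧ ∃ (m : ℕ → Fin Nf → ℝ), (∀ i f, 0 < m i f) ∧
      ∃ (R R' : ℕ → ℕ) (A : ∀ i, QCDLatticeObservable Nf (R i)) (B : ∀ i, QCDLatticeObservable Nf (R' i)),
        ∀ (i : ℕ) (C : ℝ), ∃ᶠ k in atTop, ∀ i' ≤ i, ∃ S : ℕ, reg.L k ≤ S ∧ ∃ n : ℕ, n ≤ S ∧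
          C * Real.exp (-(u i' * (reg.a k * n))) <
            ‖qcdLatticeConnectedCorr (reg.β k) (2 * S + 1) (fun fl => (reg.scheme (m i') 0 0).mq fl k)
              (A i') (B i') n‖ := by
  obtain ⟨φ, hφ, hher⟩ := hE
  obtain ⟨Φ, hΦ, -, hev⟩ := exists_eventualPin_of_hereditaryPin reg φ hφ hher
  -- witnesses at the rates `1/(i+1)`
  choose m hm R R' A B hviol using fun i : ℕ => hev (1 / ((i : ℝ) + 1)) Nat.one_div_pos_of_nat
  refine ⟨fun i => 1 / ((i : ℝ) + 1), tendsto_one_div_add_atTop_nhds_zero_nat, m, hm, R, R', A, B, fun i C => ?_⟩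
  -- the first `i + 1` scales are violated at level `C` simultaneously, eventually along `Φ`
  have hall : ∀ᶠ j in atTop, ∀ i' ∈ {i' : ℕ | i' ≤ i}, ∃ S : ℕ, reg.L (Φ j) ≤ S ∧ ∃ n : ℕ, n ≤ S ∧
      C * Real.exp (-(1 / ((i' : ℝ) + 1) * (reg.a (Φ j) * n))) <
        ‖qcdLatticeConnectedCorr (reg.β (Φ j)) (2 * S + 1) (fun fl => (reg.scheme (m i') 0 0).mq fl (Φ j))
          (A i') (B i') n‖ :=
    (eventually_all_finite (Set.finite_le_nat i)).2 fun i' _ => hviol i' C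
  exact hΦ.tendsto_atTop.frequently (hall.mono fun j hj i' hi' => hj i' hi').frequently

/-- **E* ⟺ scale-coherence of the typed pin** (the two previous theorems).  `Hyp N_f reg` supplies the right-hand
side only one scale at a time (`i' = i` alone: that is `reg.IsChiralAtZero` verbatim up to the choice of a null
sequence of rates); the finite-intersection property across scales is the residual content of `stub_hereditaryPin`. -/
theorem hereditaryPin_iff_scaleCoherent (reg : QCDRegularisation Nf) :
    (∃ φ : ℕ → ℕ, ∃ hφ : StrictMono φ, ∀ (ψ : ℕ → ℕ) (hψ : StrictMono ψ),
        ((reg.restrict φ hφ.tendsto_atTop).restrict ψ hψ.tendsto_atTop).IsChiralAtZero) ↔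
      ∃ (u : ℕ → ℝ), Tendsto u atTop (𝓝 0) ∧ ∃ (m : ℕ → Fin Nf → ℝ), (∀ i f, 0 < m i f) ∧
        ∃ (R R' : ℕ → ℕ) (A : ∀ i, QCDLatticeObservable Nf (R i)) (B : ∀ i, QCDLatticeObservable Nf (R' i)),
          ∀ (i : ℕ) (C : ℝ), ∃ᶠ k in atTop, ∀ i' ≤ i, ∃ S : ℕ, reg.L k ≤ S ∧ ∃ n : ℕ, n ≤ S ∧
            C * Real.exp (-(u i' * (reg.a k * n))) <
              ‖qcdLatticeConnectedCorr (reg.β k) (2 * S + 1) (fun fl => (reg.scheme (m i') 0 0).mq fl k)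
                (A i') (B i') n‖ :=
  ⟨scaleCoherent_of_hereditaryPin reg, fun ⟨u, hu, m, hm, R, R', A, B, h⟩ =>
    hereditaryPin_of_scaleCoherent reg u hu m hm R R' A B h⟩

end Summit.QuantumFields.QCD.Theorems.StronglyChiralSubsequence

end
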